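import Summits.BirchSwinnertonDyer.BirchSwinnertonDyer.Theorems.PlecticLegsKatoDescentGalois
import Summits.BirchSwinnertonDyer.BirchSwinnertonDyer.Theses.PlecticLegs
import HarnessLib

/-!
# BirchSwinnertonDyer / PlecticLegs — support item `KatoDescent` (stmt-BirchSwinnertonDyer-18262):
# the item from Kato's finiteness of `χ`-parts

`Summit.BirchSwinnertonDyer.BirchSwinnertonDyer.Theses.PlecticLegs.KatoDescent`: for `E/ℚ` elliptic,
`m ≥ 1`, `H ≤ Gal(ℚ(ζ_m)/ℚ)` with fixed field `F`, if every non-trivial Dirichlet character `χ`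
mod `m` trivial on `H` has `L(E, χ, 1) ≠ 0` (non-vanishing at `1` of an entire continuation of
`∑ χ(n) aₙ(E) n⁻ˢ`) then `rank_ℤ E(F) = rank_ℤ E(ℚ)`.

* `katoDescent_of_finite_chiPart` — **the item holds as soon as Kato's Cor. 14.3 (2) is available
  in curve-side form over `K = ℚ(ζ_m)`**: "if the mod-`m` twisted series of `E` has an entire
  continuation non-vanishing at `s = 1` then the `χ`-part `E(ℚ(ζ_m))^(χ)` is finite" (hypothesis
  `hKato`, literally the conclusion of the tree's named fact
  `Literature.NumberTheory.EllipticCurves.kato_finite_chiPart_of_twistedLValue_ne_zero` with the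
  curve's own coefficients). Everything else — the rank algebra (`PlecticLegsKatoDescentCore`),
  Galois descent of points and Mordell–Weil (`PlecticLegsKatoDescentGalois`), and the dictionary
  between characters of `Gal(ℚ(ζ_m)/ℚ)` and Dirichlet characters mod `m`
  (`exists_dirichletCharacter_eq_cyclotomicCharacterOf`, Mathlib `IsCyclotomicExtension.autEquivPow`)
  — is proved here.
* `finite_chiPart_of_kato_fact` — the hypothesis `hKato` for `m ≢ 2 (mod 4)` from the tree's
  named facts: modularity `exists_isNewformOf` (BCDT) and Kato's Cor. 14.3 (2) as vendored
  (`kato_finite_chiPart_of_twistedLValue_ne_zero`, newform-side, least modulus `m ≢ 2 (mod 4)`).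
  What remains between the named facts and the item is therefore exactly Kato's statement for
  `K = ℚ(ζ_m)` with `m ≡ 2 (mod 4)` (where the mod-`m` series drops the Euler factor at `2` of
  Kato's `L_{prime(m/2)}(f, χ, s)`), a convention gap recorded on the item.

References: K. Kato, Astérisque 295 (2004), Cor. 14.3 (2), p. 235; K. Rubin, *Euler systems*,
§3.5; the Galois side is folklore.
-/

set_option linter.dupNamespace false

noncomputable section

open scoped BigOperators Classical
open Polynomial Literature.NumberTheory.EllipticCurves Module WeierstrassCurve
  WeierstrassCurve.Affine
open Summit.BirchSwinnertonDyer.BirchSwinnertonDyer.Theses.PlecticLegs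

namespace Summit.BirchSwinnertonDyer.BirchSwinnertonDyer.Theorems

namespace KatoDescent

/-! ### Characters of `Gal(ℚ(ζ_m)/ℚ)` are Dirichlet characters mod `m` -/

set_option backward.isDefEq.respectTransparency false in
/-- **Dictionary `Gal(ℚ(ζ_m)/ℚ)^ = (ℤ/m)ˣ^`.** Every character `χ : Gal(ℚ(ζ_m)/ℚ) → ℂˣ` is the
cyclotomic character `cyclotomicCharacterOf χD` (transport through Mathlib's
`IsCyclotomicExtension.autEquivPow : Gal ≃* (ℤ/m)ˣ`, `σ ↦ a` with `σ ζ = ζ^a`) of a Dirichlet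
character `χD` mod `m`, and `χD(a) = χ(σ)` whenever `σ` raises the `m`-th roots of unity to the
`a`-th power (the spelling of "`σ ↦ a`" used by route PlecticLegs). [folklore] -/
theorem exists_dirichletCharacter_eq_cyclotomicCharacterOf (m : ℕ) [NeZero m]
    (χ : (CyclotomicField m ℚ ≃ₐ[ℚ] CyclotomicField m ℚ) →* ℂˣ) :
    ∃ χD : DirichletCharacter ℂ m, cyclotomicCharacterOf χD = χ ∧
      ∀ (σ : CyclotomicField m ℚ ≃ₐ[ℚ] CyclotomicField m ℚ) (a : ℕ),
        (∀ z : CyclotomicField m ℚ, z ^ m = 1 → σ z = z ^ a) → χD (a : ZMod m) = χ σ := by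
  set e := IsCyclotomicExtension.autEquivPow (CyclotomicField m ℚ)
    (cyclotomic.irreducible_rat (NeZero.pos m)) with he
  refine ⟨MulChar.ofUnitHom (χ.comp e.symm.toMonoidHom), ?_, ?_⟩
  · ext σ
    rw [coe_cyclotomicCharacterOf_apply, ← he, MulChar.ofUnitHom_coe]
    simp
  · intro σ a ha
    set ζ := IsCyclotomicExtension.zeta m ℚ (CyclotomicField m ℚ) with hζdef
    have hζ : IsPrimitiveRoot ζ m := IsCyclotomicExtension.zeta_spec m ℚ (CyclotomicField m ℚ)
    have hspec : ζ ^ ((e σ : (ZMod m)ˣ) : ZMod m).val = σ ζ := hζ.autToPow_spec ℚ σ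
    have hred : ∀ k : ℕ, ζ ^ k = ζ ^ (k % m) := fun k => by
      conv_lhs => rw [← Nat.div_add_mod k m, pow_add, pow_mul, hζ.pow_eq_one, one_pow, one_mul]
    have hmod : ((e σ : (ZMod m)ˣ) : ZMod m).val % m = a % m := by
      refine hζ.pow_inj (Nat.mod_lt _ (NeZero.pos m)) (Nat.mod_lt _ (NeZero.pos m)) ?_
      rw [← hred, ← hred, hspec, ha ζ hζ.pow_eq_one]
    have ha' : (a : ZMod m) = ((e σ : (ZMod m)ˣ) : ZMod m) := by
      rw [← ZMod.natCast_zmod_val ((e σ : (ZMod m)ˣ) : ZMod m), ZMod.natCast_eq_natCast_iff']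
      exact hmod.symm
    rw [ha', MulChar.ofUnitHom_coe]
    simp

/-- `cyclotomicCharacterOf` of the trivial Dirichlet character is trivial. [folklore] -/
theorem cyclotomicCharacterOf_one (m : ℕ) [NeZero m] :
    cyclotomicCharacterOf (1 : DirichletCharacter ℂ m) = 1 := by
  ext σ
  rw [coe_cyclotomicCharacterOf_apply, MulChar.one_apply_coe, MonoidHom.one_apply, Units.val_one]

/-! ### The item from Kato's finiteness of `χ`-parts -/

/-- **`KatoDescent` from Kato's Cor. 14.3 (2) (curve side, `K = ℚ(ζ_m)`).** Suppose that for
every elliptic `E/ℚ`, `m ≥ 1` and Dirichlet character `χ` mod `m` whose twisted series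
`∑ χ(n) aₙ(E) n⁻ˢ` has an entire continuation non-vanishing at `s = 1`, Kato's `χ`-part
`E(ℚ(ζ_m))^(χ)` of the Mordell–Weil group over `ℚ(ζ_m)` is finite (K. Kato, Astérisque 295, Cor.
14.3 (2), with `E` modular; this is the conclusion of the tree's named fact
`kato_finite_chiPart_of_twistedLValue_ne_zero` in curve-side form, cf.
`finite_chiPart_of_kato_fact`). Then `KatoDescent` holds: for `H ≤ Gal(ℚ(ζ_m)/ℚ)` with fixed
field `F` and every non-trivial `χ` trivial on `H` non-vanishing, `rank_ℤ E(F) = rank_ℤ E(ℚ)` —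
by `mordellWeilRank_fixedField_eq_of_chiPart_torsion`, a character of `Gal(ℚ(ζ_m)/ℚ)` trivial on
`H` being a Dirichlet character trivial on `H` in the route's spelling
(`exists_dirichletCharacter_eq_cyclotomicCharacterOf`). [cite: Kato2004Asterisque, Cor. 14.3 (2) (p. 235)] -/
theorem katoDescent_of_finite_chiPart
    (hKato : ∀ (W : WeierstrassCurve ℚ) [W.IsElliptic] (m : ℕ) [NeZero m]
      (χ : DirichletCharacter ℂ m),
      (∃ L : ℂ → ℂ, Differentiable ℂ L ∧
        (∀ s : ℂ, 2 < s.re → L s = LSeries (fun n ↦ χ n * ((W.LFunction n : ℤ) : ℂ)) s) ∧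
          L 1 ≠ 0) →
      Finite (chiPart
        (fun σ : CyclotomicField m ℚ ≃ₐ[ℚ] CyclotomicField m ℚ =>
          Point.map (W' := W.toAffine) (σ : CyclotomicField m ℚ →ₐ[ℚ] CyclotomicField m ℚ))
        (fun σ => (cyclotomicCharacterOf χ σ : ℂ)))) :
    KatoDescent := by
  intro W _ m _ H hχ
  refine mordellWeilRank_fixedField_eq_of_chiPart_torsion W m H fun χ hH h1 x hx => ?_
  obtain ⟨χD, hχD, hval⟩ := exists_dirichletCharacter_eq_cyclotomicCharacterOf m χ
  have hHD : ∀ σ ∈ H, ∀ a : ℕ, (∀ z : CyclotomicField m ℚ, z ^ m = 1 → σ z = z ^ a) →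
      χD (a : ZMod m) = 1 := fun σ hσ a ha => by
    rw [hval σ a ha, hH σ hσ, Units.val_one]
  have hD1 : χD ≠ 1 := fun hD => h1 (by rw [← hχD, hD, cyclotomicCharacterOf_one])
  have hfin := hKato W m χD (hχ χD hHD hD1)
  rw [hχD] at hfin
  obtain ⟨n, hn, hnx⟩ := (isOfFinAddOrder_of_finite (⟨x, hx⟩ : chiPart _ _)).exists_nsmul_eq_zero
  exact isOfFinAddOrder_iff_nsmul_eq_zero.mpr ⟨n, hn, congrArg Subtype.val hnx⟩

/-! ### The hypothesis from the tree's named facts (`m ≢ 2 mod 4`) -/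

open Literature.NumberTheory.EllipticCurves.ModularForms in
/-- **Kato's finiteness, curve side, from the named facts** (for `m ≢ 2 (mod 4)`): modularity
(`exists_isNewformOf`: `aₙ(f) = aₙ(E)` for the newform `f` of `E`, Breuil–Conrad–Diamond–Taylor
2001, Thm. A) turns the curve-side twisted series into `twistedLSeries f χ`, and Kato's Cor. 14.3 (2)
as vendored (`kato_finite_chiPart_of_twistedLValue_ne_zero`, `K = ℚ(ζ_m)`, `m ≢ 2 (mod 4)`) gives
the finiteness of `E(ℚ(ζ_m))^(χ)`. [cite: Kato2004Asterisque, Cor. 14.3 (2) (p. 235)] -/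
theorem finite_chiPart_of_kato_fact (hmod : exists_isNewformOf)
    (hK : kato_finite_chiPart_of_twistedLValue_ne_zero) (W : WeierstrassCurve ℚ) [W.IsElliptic]
    (m : ℕ) [NeZero m] (hm : m % 4 ≠ 2) (χ : DirichletCharacter ℂ m)
    (hL : ∃ L : ℂ → ℂ, Differentiable ℂ L ∧
      (∀ s : ℂ, 2 < s.re → L s = LSeries (fun n ↦ χ n * ((W.LFunction n : ℤ) : ℂ)) s) ∧
        L 1 ≠ 0) :
    Finite (chiPart
      (fun σ : CyclotomicField m ℚ ≃ₐ[ℚ] CyclotomicField m ℚ =>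
        Point.map (W' := W.toAffine) (σ : CyclotomicField m ℚ →ₐ[ℚ] CyclotomicField m ℚ))
      (fun σ => (cyclotomicCharacterOf χ σ : ℂ))) := by
  haveI : NeZero (W.conductorNorm ℤ) := ⟨(W.conductorNorm_pos_holds).ne'⟩
  obtain ⟨f, hf⟩ := hmod W
  refine hK W hf hm χ ?_
  obtain ⟨L, hLd, hLs, hL1⟩ := hL
  refine ⟨L, hLd, fun s hs => ?_, hL1⟩
  rw [hLs s hs, twistedLSeries]
  congr 1
  funext n
  rw [hf.2 n]

end KatoDescent

/-- **The item `KatoDescent`, conditional form (re-export at the route's namespace level).**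
`KatoDescent` follows from Kato's finiteness of `χ`-parts over `ℚ(ζ_m)` in curve-side form
(`KatoDescent.katoDescent_of_finite_chiPart`); see the module docstring for what is proved and
what is taken as hypothesis. [cite: Kato2004Asterisque, Cor. 14.3 (2) (p. 235)] -/
theorem plecticLegs_katoDescent_of_finite_chiPart
    (hKato : ∀ (W : WeierstrassCurve ℚ) [W.IsElliptic] (m : ℕ) [NeZero m]
      (χ : DirichletCharacter ℂ m),
      (∃ L : ℂ → ℂ, Differentiable ℂ L ∧
        (∀ s : ℂ, 2 < s.re → L s = LSeries (fun n ↦ χ n * ((W.LFunction n : ℤ) : ℂ)) s) ∧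
          L 1 ≠ 0) →
      Finite (chiPart
        (fun σ : CyclotomicField m ℚ ≃ₐ[ℚ] CyclotomicField m ℚ =>
          Point.map (W' := W.toAffine) (σ : CyclotomicField m ℚ →ₐ[ℚ] CyclotomicField m ℚ))
        (fun σ => (cyclotomicCharacterOf χ σ : ℂ)))) :
    KatoDescent :=
  KatoDescent.katoDescent_of_finite_chiPart hKato

end Summit.BirchSwinnertonDyer.BirchSwinnertonDyer.Theorems

end
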